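import Mathlib
import Literature.Computability.AlgebraicComplexity.StandardFamilies
import Literature.Computability.AlgebraicComplexity.PermanentIrreducible
import Summits.ValiantsHypothesis.ValiantsHypothesis.Theses.RefutationDegree
import Summits.ValiantsHypothesis.ValiantsHypothesis.Theorems.RefutationDegreeDefs
import Summits.ValiantsHypothesis.ValiantsHypothesis.Theorems.RefutationDegreeRefutationBarrierPencilCoeff

/-!
# Crux `RefutationBarrier` (stmt-ValiantsHypothesis-5642), line `Sketch-ideator1`: degree grading

Lead's file (prover-line-stmt-ValiantsHypothesis-5642-0).  THE UNCONDITIONAL HALF OF THE CRUX: for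
`m ≥ n` and `D < m`, Rep(n,m) has no Hermitian-SOS refutation with products of degree `≤ D`
(`not_hasSosRef_of_lt`); hence for every `c`, `n`, and every `m > n ^ c` (`m ≥ n`) the inner negation
of `RefutationBarrier` holds outright (`refutationBarrier_large`), and the instances `c ≤ 1` of the
crux are theorems.  Ingredients: the diagonal witness pencil `diag(x_{σ 0,0}, …, x_{σ(n-1),n-1}, 1, …, 1)`
shows that every permutation monomial occurs in some size-`m` determinant
(`coeff_det_pencil_permMonomial_ne_zero`), so EVERY equation `P.coeff μ`, `μ ∈ supp P`, has total
degree `≥ m` (`le_totalDegree_coeff_defect_of_mem_support`); a product `h_μ · eqn_μ` of degree `< m`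
therefore has `h_μ = 0` (`ℂ[a, ā]` is a domain), and what is left, `Σ_i q_i · cj q_i + 1 = 0`, is absurd
at the conjugate point `0` (`eval_mul_cj`).  The content of the crux starts at `m ≤ n ^ c`.

Vocabulary from `Theorems/RefutationDegreeDefs.lean`; pencil facts from
`Theorems/RefutationDegreeRefutationBarrierPencilCoeff.lean`.  All folklore.
-/

-- `Summit.ValiantsHypothesis.ValiantsHypothesis.…` is the tree's mandated single-conjunct layout
-- (Sub = Summit), so the duplicated namespace component is intended.
set_option linter.dupNamespace false

noncomputable section

namespace Summit.ValiantsHypothesis.ValiantsHypothesis.Theorems.RefutationDegree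

open scoped BigOperators
open Filter Topology MvPolynomial
open Literature.Computability.AlgebraicComplexity (perPoly)
open Summit.ValiantsHypothesis.ValiantsHypothesis.Theses.RefutationDegree

/-! ## Degree grading: no Hermitian-SOS refutation of degree `D < m` once `m ≥ n`

(`RefutationDegreeRefutationBarrierGrading.lean`, lead.)  For `m ≥ n` every permutation monomial
`x^{μ_σ}` occurs in `det A(x)` for a suitable (diagonal) pencil, so EVERY equation of Rep(n,m) has the
shape `F_μ − c_μ` with `F_μ ≠ 0` a form of degree exactly `m`; a product `h_μ · eqn_μ` of degree `< m`
therefore has `h_μ = 0`, and what is left of a refutation, `Σ_i q_i·cj q_i + 1 = 0`, is absurd at the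
conjugate point `0`.  Consequence: the instances `c ≤ 1` of the crux, and the half `m > n^c` of every
instance, hold outright (`refutationBarrier_large`). -/

section Witness

open Literature.Computability.AlgebraicComplexity (permMonomial)

variable {n k : ℕ}

/-- **Every permutation monomial occurs in some size-`(n+k)` affine determinant**: the
`x^{μ_σ}`-coefficient `F_{μ_σ}` of `det A(x)` is a NONZERO form in the unknowns.  Witness: the
diagonal pencil `A(x) = diag(x_{σ 0,0}, …, x_{σ(n-1),n-1}, 1, …, 1)` (`A₀ = 0 ⊕ 1_k`,
`A_{(σ c, c)} = E_{cc}`, all other `A_e = 0`), whose determinant is `x^{μ_σ}`. [folklore] -/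
theorem coeff_det_pencil_permMonomial_ne_zero (σ : Equiv.Perm (Fin n)) (k : ℕ) :
    ((pencil n (n + k)).det).coeff (permMonomial σ) ≠ 0 := by
  classical
  -- the witness point of unknown-space and the diagonal entries of the witness pencil
  let a : Unk n (n + k) → ℂ := fun u => match u with
    | (none, (i, j)) => if i = j ∧ n ≤ (i : ℕ) then 1 else 0
    | (some (r, c), (i, j)) => if i = j ∧ (i : ℕ) = (c : ℕ) ∧ r = σ c then 1 else 0
  let d : Fin (n + k) → MvPolynomial (Fin n × Fin n) ℂ := fun i =>
    if h : (i : ℕ) < n then MvPolynomial.X (σ ⟨i, h⟩, ⟨i, h⟩) else 1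
  -- specialising the generic pencil at `a` gives the diagonal witness pencil
  have hmap : (pencil n (n + k)).map (MvPolynomial.map (MvPolynomial.eval a)) = Matrix.diagonal d := by
    ext i j : 2
    simp only [Matrix.map_apply, pencil, Matrix.of_apply, map_add, map_sum, map_mul,
      MvPolynomial.map_X, MvPolynomial.map_C, MvPolynomial.eval_X, Matrix.diagonal_apply, d, a]
    by_cases hij : i = j
    · subst hij
      simp only [true_and, if_true]
      by_cases hi : (i : ℕ) < n
      · rw [dif_pos hi, if_neg (not_le.mpr hi), map_zero, zero_add]
        rw [Finset.sum_eq_single (σ ⟨i, hi⟩, ⟨i, hi⟩)]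
        · simp
        · rintro ⟨r, c⟩ - hne
          have : ¬ ((i : ℕ) = (c : ℕ) ∧ r = σ c) := by
            rintro ⟨hc, rfl⟩
            apply hne
            have hc' : (⟨(i : ℕ), hi⟩ : Fin n) = c := Fin.ext hc
            subst hc'
            rfl
          rw [if_neg this, map_zero, mul_zero]
        · intro h; exact absurd (Finset.mem_univ _) h
      · rw [dif_neg hi, if_pos (not_lt.mp hi), map_one]
        rw [Finset.sum_eq_zero]
        · rw [add_zero]
        · rintro ⟨r, c⟩ -
          have : ¬ ((i : ℕ) = (c : ℕ) ∧ r = σ c) := by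
            rintro ⟨hc, -⟩
            exact hi (hc ▸ c.isLt)
          rw [if_neg this, map_zero, mul_zero]
    · rw [if_neg hij]
      simp only [hij, false_and, if_false, map_zero, mul_zero, Finset.sum_const_zero, add_zero]
  -- its determinant is the permutation monomial
  have hdet : (Matrix.diagonal d).det = MvPolynomial.monomial (permMonomial σ) (1 : ℂ) := by
    rw [Matrix.det_diagonal, Fin.prod_univ_add]
    have h1 : ∀ c : Fin n, d (Fin.castAdd k c) = MvPolynomial.X (σ c, c) := by
      intro c
      have hc : ((Fin.castAdd k c : Fin (n + k)) : ℕ) < n := by simp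
      simp only [d, dif_pos hc]
      congr 2
    have h2 : ∀ i : Fin k, d (Fin.natAdd n i) = 1 := by
      intro i
      have : ¬ ((Fin.natAdd n i : Fin (n + k)) : ℕ) < n := by simp
      simp only [d, dif_neg this]
    simp only [h1, h2, Finset.prod_const_one, mul_one]
    rw [permMonomial, MvPolynomial.monomial_sum_one]
    rfl
  intro h0
  have h1 : MvPolynomial.eval a (((pencil n (n + k)).det).coeff (permMonomial σ)) = 1 := by
    rw [← MvPolynomial.coeff_map, RingHom.map_det, RingHom.mapMatrix_apply, hmap, hdet,
      MvPolynomial.coeff_monomial, if_pos rfl]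
  rw [h0, map_zero] at h1
  exact zero_ne_one h1

end Witness

section Grading

open Literature.Computability.AlgebraicComplexity (permMonomial
  exists_permMonomial_eq_of_coeff_perPoly_ne_zero)

/-- For `m ≥ n`, EVERY equation of Rep(n,m) has total degree `≥ m` in the unknowns (the constant
equations `−c_μ = 0` only occur below the degree of the permanent). [folklore] -/
theorem le_totalDegree_coeff_defect_of_mem_support {n m : ℕ} (hnm : n ≤ m)
    {μ : (Fin n × Fin n) →₀ ℕ} (hμ : μ ∈ (defect n m).support) :
    m ≤ ((defect n m).coeff μ).totalDegree := by
  refine le_totalDegree_coeff_defect n m μ fun hF => ?_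
  -- if `F_μ = 0` then `P.coeff μ = −C c_μ ≠ 0`, so `μ` is a permutation monomial — but those occur
  have hc : MvPolynomial.coeff μ (perPoly (Fin n) ℂ) ≠ 0 := by
    intro hc
    apply MvPolynomial.mem_support_iff.mp hμ
    rw [coeff_defect, hF, hc, map_zero, sub_zero]
  obtain ⟨σ, rfl⟩ := exists_permMonomial_eq_of_coeff_perPoly_ne_zero (R := ℂ) hc
  obtain ⟨k, rfl⟩ := Nat.exists_eq_add_of_le hnm
  exact coeff_det_pencil_permMonomial_ne_zero σ k hF

/-- `rename` along an injective map preserves the total degree. [folklore] -/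
theorem totalDegree_rename_of_injective {σ τ : Type*} {f : σ → τ} (hf : Function.Injective f)
    (p : MvPolynomial σ ℂ) : (MvPolynomial.rename f p).totalDegree = p.totalDegree := by
  classical
  refine le_antisymm (MvPolynomial.totalDegree_rename_le f p) ?_
  rw [MvPolynomial.totalDegree, MvPolynomial.totalDegree, MvPolynomial.support_rename_of_injective hf,
    Finset.sup_image]
  refine Finset.sup_le fun d hd => ?_
  have hsum : ((Finsupp.mapDomain f d).sum fun _ e => e) = d.sum fun _ e => e :=
    Finsupp.sum_mapDomain_index_inj hf
  calc (d.sum fun _ e => e)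
      = ((fun s : τ →₀ ℕ => s.sum fun _ e => e) ∘ Finsupp.mapDomain f) d := hsum.symm
    _ ≤ _ := Finset.le_sup hd

/-- **DEGREE GRADING.** For `m ≥ n` and `D < m`, Rep(n,m) has NO Hermitian-SOS refutation with products
of degree `≤ D`: every `h_μ · eqn_μ` vanishes for degree reasons and `Σ_i |q_i(0)|² + 1 = 0` is
impossible. [folklore] -/
theorem not_hasSosRef_of_lt {n m D : ℕ} (hnm : n ≤ m) (hD : D < m) : ¬ HasSosRef n m D := by
  classical
  rintro ⟨k, q, h, -, hh, hsum⟩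
  -- every ideal term vanishes
  have hzero : ∀ μ ∈ (defect n m).support, h μ * eqn n m μ = 0 := by
    intro μ hμ
    by_contra hne
    have hh0 : h μ ≠ 0 := fun h0 => hne (by rw [h0, zero_mul])
    have he0 : eqn n m μ ≠ 0 := fun h0 => hne (by rw [h0, mul_zero])
    have hdeg := hh μ
    rw [MvPolynomial.totalDegree_mul_of_isDomain hh0 he0] at hdeg
    have hm : m ≤ (eqn n m μ).totalDegree := by
      unfold eqn
      rw [totalDegree_rename_of_injective Sum.inl_injective]
      exact le_totalDegree_coeff_defect_of_mem_support hnm hμ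
    omega
  have hsum' : ∑ i, q i * cj (Unk n m) (q i) + 1 = 0 := by
    have hmid : ∑ μ ∈ (defect n m).support,
        (h μ * eqn n m μ + cj (Unk n m) (h μ * eqn n m μ)) = 0 := by
      refine Finset.sum_eq_zero fun μ hμ => ?_
      rw [hzero μ hμ]
      simp [cj]
    rwa [hmid, add_zero] at hsum
  -- evaluate at the conjugate point 0
  have hv : ∀ u : Unk n m, (0 : Unk n m ⊕ Unk n m → ℂ) (Sum.inr u)
      = (starRingEnd ℂ) ((0 : Unk n m ⊕ Unk n m → ℂ) (Sum.inl u)) := by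
    intro u; simp
  have heval := congrArg (MvPolynomial.eval (0 : Unk n m ⊕ Unk n m → ℂ)) hsum'
  rw [map_add, map_sum, map_one, map_zero] at heval
  simp only [eval_mul_cj _ hv] at heval
  -- real parts: `Σ normSq + 1 = 0` is absurd
  have hre := congrArg Complex.re heval
  rw [Complex.add_re, Complex.re_sum, Complex.one_re, Complex.zero_re] at hre
  simp only [Complex.ofReal_re] at hre
  have hnn : 0 ≤ ∑ i, Complex.normSq (MvPolynomial.eval (0 : Unk n m ⊕ Unk n m → ℂ) (q i)) :=
    Finset.sum_nonneg fun i _ => Complex.normSq_nonneg _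
  linarith

/-- The UNCONDITIONAL half of the crux: for every `c`, every `n`, and every size `m ≥ n` beyond the
degree budget (`n ^ c < m`), Rep(n,m) has no Hermitian-SOS refutation of product degree `≤ n ^ c`.
In particular the instances `c ≤ 1` of `RefutationBarrier` hold outright. [folklore] -/
theorem refutationBarrier_large (c n m : ℕ) (hnm : n ≤ m) (hm : n ^ c < m) :
    ¬ HasSosRef n m (n ^ c) :=
  not_hasSosRef_of_lt hnm hm

end Grading

end Summit.ValiantsHypothesis.ValiantsHypothesis.Theorems.RefutationDegree

end
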